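/-
Copyright (c) 2026 the pub-hodgecm-mathlib formalisation cell (harness21).  Prover seat hodgecm-mathlib-R90-C14-p02 (g3) (section S6, dealer R90-C14-plan (g2),
card (G1) «E1-DISCHARGE», R90 bus 2026-09-05T03:03:11Z; census `R90/R90-C14-p02/g3/G1-DISCHARGE-CENSUS.md` 7afcecd4, rulings (Q1)(Q2) + «PLAN =» 03:09:36Z).
FILE 1a = the SHELL PLUMBING of the reduction (E1) ⟸ (U0) ∧ (U1).  THEOREMS ONLY (no `def`, no `instance`, no notation, no named-fact hypothesis, no `sorry`);
lane `--supports stmt-HodgeConjecture-24833 --as helper` (count-neutral helper).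
-/
import Summits.HodgeConjecture.HodgeConjecture.Theorems.R90S6TreeFixDataCosetShellsU3      -- ★ GF1 2a p864913: §1 plumbing, §2 `ncard_displaced_two_{typeTwo,selfDual}_add_natCard_fixedBy_eq`
import Summits.HodgeConjecture.HodgeConjecture.Theorems.R90S6TreeFixDataUnramifiedU2      -- ★ HF1 A3 p864919: `latticeTreeIso_compression_apply_eq_self_iff_dist_le` (Fix δ₁ = Ball(x₀, n))
import Summits.HodgeConjecture.HodgeConjecture.Theorems.R90S6TreeTypeSwapU2Transport      -- ★ Transport p864794: `ncard_selfDual_dist_conj_eq_ncard_modular_dist_of_datum`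
import Summits.HodgeConjecture.HodgeConjecture.Theorems.R90S6HSideEllipticValueClosed       -- ★ H2-NUMBERS: `sum_xiHCoeff_mul_shell_eq`, `xiHCoeff_self`
import Summits.HodgeConjecture.HodgeConjecture.Theorems.R90S6TreeDisplacementSphereCount    -- ★ W8-f: `ncard_displaced_eq_of_regular`
import Summits.HodgeConjecture.HodgeConjecture.Theorems.R90S6FlickerLiteralRegimes          -- ★ regimes p864712: `flickerLiteral_norm_one_letters`
import Literature.Combinatorics.SimpleGraph.LocallyFiniteBall                               -- ★ `ClosedBall.finite_setOf_dist_le`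
import HarnessLib

/-!
# R90 · S6 — CARD (G1) «E1-DISCHARGE», FILE 1a: SHELL PLUMBING FOR THE TYPE-(1) ELLIPTIC κ-IDENTITY — total shells on `X₂`, the (E1) pair `(δ₁, δ₂)`,
# and the hyperspecial shells of a `U₃`-literal from its two fixed-coset counts without `horb` (`Theorems/R90S6EllipticIdentityTypeOneShells.lean`)

Cell `hodgecm-mathlib`, crux H413 (`stmt-HodgeConjecture-24833`), route of record `HCCMUnconditional`; programme R90-TF, section S6 (base `R90-C14`), seat
R90-C14-p02 (g3); card (G1) «E1-DISCHARGE» (dealer R90-C14-plan (g2), R90 bus 2026-09-05T03:03:11Z), census 7afcecd4 §0 ADOPTED AS RECORD 03:09:36Z.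
Consumer: FILE 1b `Theorems/R90S6EllipticIdentityTypeOneReduction.lean` ((E1) ⟸ (U0) ∧ (U1)).

THE MATHEMATICS (census §0).  On the `(q+1)`-REGULAR tree `X₂` of `U(1,1)_w` the TOTAL displacement shells `T(k) = #{x : d(x, δx) = 2k}` of an elliptic `δ` with finite
non-empty fixed set `Fix δ` (`Φ = #Fix δ`) satisfy `T(0) = Φ`, `T(k) = q^{k−1} T(1)` (★ W8-f §3) and `T(1) + 2Φ = (q+1)Φ + 2` (the fixed set is a finite subtree: ★ GF1 FILE 1),
so ★ H2-NUMBERS' closed sum reads `Σ_{k ≤ m} xiHCoeff q m k · T(k) = (q²−1)q^{2(m−1)}Φ + ((q²−1)q^{2m−3}·[m even ? −1 : 0] + (−1)^m q^{2m−1})·T(1)` (§2).  For the (E1)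
pair `δ₂ = diag(ϖ,1)·δ₁·diag(ϖ,1)⁻¹` (§3, a `GL₂` identity between the two literals) ★ Transport turns the `δ₂`-shell of SELF-DUAL vertices into the `δ₁`-shell of
`ϖ`-MODULAR ones, so the two H-sums of (E1) add up to the sum against the total shells of `δ₁`, whose fixed set is the finite ball `Ball(x₀, v(a−c))` (★ HF1 A3).  On `X₃`
(§3b) the hyperspecial shells of any `γ ∈ U₃` with finite fixed-coset sets `Fix_γ(U⧸K₀)`, `Fix_γ(U⧸K₁)` ONE OF WHICH IS NON-EMPTY follow from `(V₀, V₁) = (#Fix_γ(U⧸K₀),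
#Fix_γ(U⧸K₁))` exactly as in ★ GF1 2a §4, the fixed vertex being read off the non-empty coset set (★ DICT0) instead of the finite-orbit letter `horb`.
* §1 `sum_neg_one_pow_Ico_one_eq`; §2 `ncard_displaced_two_add_two_mul_ncard_fixed_eq`, `sum_xiHCoeff_mul_ncard_displaced_total_eq`;
* §3 `coe_compression_pi_eq_zpowDiagGL_conj`, `ncard_selfDual_displaced_add_eq_ncard_displaced`, `exists_v_sub_eq_exp_neg`, `setOf_compression_fixed_eq_ball`,
  `finite_compression_fixed`; §3b `exists_latticeGraphIso_apply_eq_self_of_fixedBy_nonempty`, **`ncard_selfDual_displaced_eq_of_finite_fixedBy`**.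
HONEST LABEL: bookkeeping over ★ files; proves no printed statement, discharges no citation; count-neutral until (E1) consumes it.  HC_CM is proved only modulo the 7
printed citations (2 remaining named inputs: hLiu418 = stmt-HodgeConjecture-24832, h413 = stmt-HodgeConjecture-24833) until rung 0 closes; REL ≠ ★ ≠ BUILT.

## References
* [Rogawski1990] J. D. Rogawski, *Automorphic Representations of Unitary Groups in Three Variables*, Ann. of Math. Stud. 123 (1990): §4.9 Prop. 4.9.1 (b) pp. 54–55,
  Lemma 4.9.3 p. 56, §3.5–3.6 pp. 29–32.
* [LabesseLanglands1979] J.-P. Labesse, R. P. Langlands, *L-indistinguishability for SL(2)*, Canad. J. Math. 31 (1979), §§2–3.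
* [Kottwitz1988] R. E. Kottwitz, *Tamagawa numbers*, Ann. of Math. 127 (1988), §2 (the fixed subtree of an elliptic element).
* [Serre1980Trees] J.-P. Serre, *Trees* (1980), I.2.3 Ex. 2, I.6.1, I.6.4 Prop. 24, II.1.1.
* [Macdonald1971] I. G. Macdonald, *Spherical Functions on a Group of p-adic Type* (1971), Ch. V §3.
-/


set_option autoImplicit false
-- the mandated namespace repeats the single-problem summit's segment (`HodgeConjecture.HodgeConjecture`)
set_option linter.dupNamespace false

noncomputable section

open MulAction SimpleGraph Finset
open scoped Valued WithZero Matrix MatrixGroups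
open Literature.NumberTheory.Automorphic Literature.NumberTheory.Automorphic.HermitianLattice Literature.NumberTheory.Automorphic.UnitaryGroup
open Literature.Combinatorics.SimpleGraph

namespace Summit.HodgeConjecture.HodgeConjecture.R90.S6

/-! ## §1 Arithmetic: the alternating sum `Σ_{1 ≤ k < m} (−1)^k` -/

/-- `Σ_{k ∈ [1, m)} (−1)^k = −1` if `m` is even and `0` if `m` is odd (`m ≥ 1`). [folklore] -/
theorem sum_neg_one_pow_Ico_one_eq (m : ℕ) (hm : 1 ≤ m) :
    ∑ k ∈ Finset.Ico 1 m, (-1 : ℂ) ^ k = if Even m then -1 else 0 := by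
  induction m, hm using Nat.le_induction with
  | base => rw [Finset.Ico_self, Finset.sum_empty, if_neg Nat.not_even_one]
  | succ m hm ih =>
    rw [Finset.sum_Ico_succ_top hm, ih]
    by_cases he : Even m
    · have hne : ¬ Even (m + 1) := fun h => Nat.even_add_one.1 h he
      rw [if_pos he, if_neg hne, he.neg_one_pow]; ring
    · have he' : Even (m + 1) := Nat.even_add_one.2 he
      rw [if_neg he, if_pos he', (Nat.not_even_iff_odd.1 he).neg_one_pow]; ring

/-! ## §2 `X₂`: the total displacement shells of an elliptic `δ ∈ U₂` against `(Φ, T(1))` -/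

section Two

variable {K : Type} [Field K] [Valued K ℤᵐ⁰] [ValuativeRel K] [(Valued.v : Valuation K ℤᵐ⁰).Compatible] {σ : K →+* K} {ϖ : K}

/-- **`T(1) + 2Φ = (q+1)·Φ + 2` on the `(q+1)`-regular tree `X₂`**: for `δ ∈ U₂` fixing a vertex `u` with finite fixed set `Fix δ` (`Φ = #Fix δ`) on the tree with finite
neighbour sets of constant valency `q + 1`, the first total displacement shell `T(1) = #{x : d(x, δx) = 2}` satisfies `T(1) + 2Φ = (q+1)Φ + 2` — the fixed set is a finite
subtree with `Φ − 1` edges (★ GF1 FILE 1 `ncard_displaced_two_inter_type_add_card_fixed_eq` at both types of the self-dual ∕ `ϖ`-modular colouring ★ `typeFun_ne_of_adj_two`).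
[cite: Kottwitz1988, §2] [cite: Serre1980Trees, I.6.1, I.6.4 Prop. 24, II.1.1] -/
theorem ncard_displaced_two_add_two_mul_ncard_fixed_eq (hd : HermitianLattice.UnramifiedLocalConjDatum σ ϖ)
    (δ : unitaryGroupOfForm σ ((StdForm.antidiagonal 2).over K))
    {u : {M : Submodule (ValuativeRel.valuation K).integer (Fin 2 → K) // HermitianLatticeTree.IsSpecialLattice σ ϖ ((StdForm.antidiagonal 2).over K) M}}
    (hu : HermitianLatticeTree.latticeTreeIso σ ϖ ((StdForm.antidiagonal 2).over K) δ u = u)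
    (hfix : {v | HermitianLatticeTree.latticeTreeIso σ ϖ ((StdForm.antidiagonal 2).over K) δ v = v}.Finite)
    (hloc : ∀ v, ((HermitianLatticeTree.latticeTree σ ϖ ((StdForm.antidiagonal 2).over K)).neighborSet v).Finite) (q : ℕ)
    (hreg : ∀ v, ((HermitianLatticeTree.latticeTree σ ϖ ((StdForm.antidiagonal 2).over K)).neighborSet v).ncard = q + 1) :
    {x : {M : Submodule (ValuativeRel.valuation K).integer (Fin 2 → K) // HermitianLatticeTree.IsSpecialLattice σ ϖ ((StdForm.antidiagonal 2).over K) M} |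
        (HermitianLatticeTree.latticeTree σ ϖ ((StdForm.antidiagonal 2).over K)).dist x
          (HermitianLatticeTree.latticeTreeIso σ ϖ ((StdForm.antidiagonal 2).over K) δ x) = 2}.ncard +
      2 * {v | HermitianLatticeTree.latticeTreeIso σ ϖ ((StdForm.antidiagonal 2).over K) δ v = v}.ncard =
      (q + 1) * {v | HermitianLatticeTree.latticeTreeIso σ ϖ ((StdForm.antidiagonal 2).over K) δ v = v}.ncard + 2 := by
  classical
  haveI := isDiscreteValuationRing_integer_of_compatible hd.vϖ
  have hT := HermitianLatticeTree.isTree_latticeTree σ (valuation_map_eq_of_datum hd) (isUniformizingElement_of_v_eq hd.vϖ)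
    (isUnimodular₂_antidiagonal_two (K := K))
  haveI : (HermitianLatticeTree.latticeTree σ ϖ ((StdForm.antidiagonal 2).over K)).LocallyFinite := fun v => (hloc v).fintype
  -- the self-dual ∕ modular type function
  let c : {M : Submodule (ValuativeRel.valuation K).integer (Fin 2 → K) // HermitianLatticeTree.IsSpecialLattice σ ϖ ((StdForm.antidiagonal 2).over K) M} → Fin 2 :=
    fun v => if HermitianLatticeTree.IsSelfDualLattice σ ((StdForm.antidiagonal 2).over K) v.1 then 0 else 1
  have hc0 : ∀ v, c v = 0 ↔ HermitianLatticeTree.IsSelfDualLattice σ ((StdForm.antidiagonal 2).over K) v.1 := fun v => by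
    by_cases h : HermitianLatticeTree.IsSelfDualLattice σ ((StdForm.antidiagonal 2).over K) v.1 <;> simp [c, h]
  have hc := typeFun_ne_of_adj_two hd c hc0
  have hdeg : ∀ y, HermitianLatticeTree.latticeTreeIso σ ϖ ((StdForm.antidiagonal 2).over K) δ y = y →
      (HermitianLatticeTree.latticeTree σ ϖ ((StdForm.antidiagonal 2).over K)).degree y = (fun _ : Fin 2 => q + 1) (c y) := fun y _ => by
    rw [TreeDisplacement.degree_eq_ncard_neighborSet, hreg y]
  have h01 : (0 : Fin 2) ≠ 1 := by decide
  have hA := ncard_displaced_two_inter_type_add_card_fixed_eq hT (HermitianLatticeTree.latticeTreeIso σ ϖ ((StdForm.antidiagonal 2).over K) δ) hu hfix c hc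
    h01 (fun _ : Fin 2 => q + 1) hdeg
  have hB := ncard_displaced_two_inter_type_add_card_fixed_eq hT (HermitianLatticeTree.latticeTreeIso σ ϖ ((StdForm.antidiagonal 2).over K) δ) hu hfix c hc
    h01.symm (fun _ : Fin 2 => q + 1) hdeg
  -- the type split of the fixed set and of the first shell
  have hF := card_toFinset_eq_card_filter_add hfix c
  have hS2fin : {x : {M : Submodule (ValuativeRel.valuation K).integer (Fin 2 → K) // HermitianLatticeTree.IsSpecialLattice σ ϖ ((StdForm.antidiagonal 2).over K) M} |
      (HermitianLatticeTree.latticeTree σ ϖ ((StdForm.antidiagonal 2).over K)).dist x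
        (HermitianLatticeTree.latticeTreeIso σ ϖ ((StdForm.antidiagonal 2).over K) δ x) = 2}.Finite := by
    simpa only [mul_one] using TreeDisplacement.finite_setOf_dist_self_apply_eq hT
      (HermitianLatticeTree.latticeTreeIso σ ϖ ((StdForm.antidiagonal 2).over K) δ) hu hfix 1
  have hS := card_toFinset_eq_card_filter_add hS2fin c
  have hSi : ∀ i : Fin 2, (hS2fin.toFinset.filter (fun y => c y = i)).card =
      {x | (HermitianLatticeTree.latticeTree σ ϖ ((StdForm.antidiagonal 2).over K)).dist x
        (HermitianLatticeTree.latticeTreeIso σ ϖ ((StdForm.antidiagonal 2).over K) δ x) = 2 ∧ c x = i}.ncard := fun i => by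
    rw [← Set.ncard_coe_finset]
    congr 1
    ext v
    simp only [Finset.coe_filter, Set.Finite.mem_toFinset, Set.mem_setOf_eq]
  rw [Set.ncard_eq_toFinset_card _ hfix, Set.ncard_eq_toFinset_card _ hS2fin, hS, hSi 0, hSi 1]
  rw [hF] at hA hB ⊢
  simp only [mul_add]
  omega

/-- **THE CLOSED H-SUM AGAINST `(Φ, T(1))`**: for `δ ∈ U₂` fixing a vertex with finite fixed set `Fix δ` (`Φ = #Fix δ`) on the `(q+1)`-regular tree `X₂` and `m ≥ 1`,
`Σ_{k ≤ m} xiHCoeff q m k · T(k) = (q²−1) q^{2(m−1)} Φ + ((q²−1) q^{2m−3} · [m even ? −1 : 0] + (−1)^m q^{2m−1}) · T(1)`, `T(k) = #{x : d(x, δx) = 2k}` the TOTAL shell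
(`T(0) = Φ`, `T(k) = q^{k−1} T(1)` ★ W8-f `ncard_displaced_eq_of_regular`; ★ H2-NUMBERS `sum_xiHCoeff_mul_shell_eq` at `N₀ = N₁ = T(1)`; §1).
[cite: Rogawski1990, §4.9 pp. 54–55] [cite: Macdonald1971, Ch. V §3] [cite: Serre1980Trees, I.2.3 Ex. 2, I.6.4 Prop. 24] -/
theorem sum_xiHCoeff_mul_ncard_displaced_total_eq (hd : HermitianLattice.UnramifiedLocalConjDatum σ ϖ)
    (δ : unitaryGroupOfForm σ ((StdForm.antidiagonal 2).over K))
    {u : {M : Submodule (ValuativeRel.valuation K).integer (Fin 2 → K) // HermitianLatticeTree.IsSpecialLattice σ ϖ ((StdForm.antidiagonal 2).over K) M}}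
    (hu : HermitianLatticeTree.latticeTreeIso σ ϖ ((StdForm.antidiagonal 2).over K) δ u = u)
    (hfix : {v | HermitianLatticeTree.latticeTreeIso σ ϖ ((StdForm.antidiagonal 2).over K) δ v = v}.Finite)
    (hloc : ∀ v, ((HermitianLatticeTree.latticeTree σ ϖ ((StdForm.antidiagonal 2).over K)).neighborSet v).Finite) (q : ℕ)
    (hreg : ∀ v, ((HermitianLatticeTree.latticeTree σ ϖ ((StdForm.antidiagonal 2).over K)).neighborSet v).ncard = q + 1) (m : ℕ) (hm : 1 ≤ m) :
    ∑ k ∈ Finset.range (m + 1), xiHCoeff q m k *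
        (({x : {M : Submodule (ValuativeRel.valuation K).integer (Fin 2 → K) // HermitianLatticeTree.IsSpecialLattice σ ϖ ((StdForm.antidiagonal 2).over K) M} |
            (HermitianLatticeTree.latticeTree σ ϖ ((StdForm.antidiagonal 2).over K)).dist x
              (HermitianLatticeTree.latticeTreeIso σ ϖ ((StdForm.antidiagonal 2).over K) δ x) = 2 * k}.ncard : ℕ) : ℂ) =
      ((q : ℂ) ^ 2 - 1) * (q : ℂ) ^ (2 * (m - 1)) *
          (({v | HermitianLatticeTree.latticeTreeIso σ ϖ ((StdForm.antidiagonal 2).over K) δ v = v}.ncard : ℕ) : ℂ) +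
        (((q : ℂ) ^ 2 - 1) * (q : ℂ) ^ (2 * m - 3) * (if Even m then -1 else 0) + (-1 : ℂ) ^ m * (q : ℂ) ^ (2 * m - 1)) *
          (({x : {M : Submodule (ValuativeRel.valuation K).integer (Fin 2 → K) // HermitianLatticeTree.IsSpecialLattice σ ϖ ((StdForm.antidiagonal 2).over K) M} |
              (HermitianLatticeTree.latticeTree σ ϖ ((StdForm.antidiagonal 2).over K)).dist x
                (HermitianLatticeTree.latticeTreeIso σ ϖ ((StdForm.antidiagonal 2).over K) δ x) = 2}.ncard : ℕ) : ℂ) := by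
  classical
  haveI := isDiscreteValuationRing_integer_of_compatible hd.vϖ
  have hT := HermitianLatticeTree.isTree_latticeTree σ (valuation_map_eq_of_datum hd) (isUniformizingElement_of_v_eq hd.vϖ)
    (isUnimodular₂_antidiagonal_two (K := K))
  haveI : (HermitianLatticeTree.latticeTree σ ϖ ((StdForm.antidiagonal 2).over K)).LocallyFinite := fun v => (hloc v).fintype
  have hdeg : ∀ v, HermitianLatticeTree.latticeTreeIso σ ϖ ((StdForm.antidiagonal 2).over K) δ v ≠ v →
      (HermitianLatticeTree.latticeTree σ ϖ ((StdForm.antidiagonal 2).over K)).degree v = q + 1 := fun v _ => by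
    rw [TreeDisplacement.degree_eq_ncard_neighborSet, hreg v]
  -- `T(0) = Φ`
  have h0 : {x : {M : Submodule (ValuativeRel.valuation K).integer (Fin 2 → K) // HermitianLatticeTree.IsSpecialLattice σ ϖ ((StdForm.antidiagonal 2).over K) M} |
        (HermitianLatticeTree.latticeTree σ ϖ ((StdForm.antidiagonal 2).over K)).dist x
          (HermitianLatticeTree.latticeTreeIso σ ϖ ((StdForm.antidiagonal 2).over K) δ x) = 2 * 0}.ncard =
      {v | HermitianLatticeTree.latticeTreeIso σ ϖ ((StdForm.antidiagonal 2).over K) δ v = v}.ncard := by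
    congr 1
    ext x
    simp only [Set.mem_setOf_eq, Nat.mul_zero, hT.connected.dist_eq_zero_iff]
    exact eq_comm
  rw [sum_xiHCoeff_mul_shell_eq q m hm
    (fun k => {x : {M : Submodule (ValuativeRel.valuation K).integer (Fin 2 → K) // HermitianLatticeTree.IsSpecialLattice σ ϖ ((StdForm.antidiagonal 2).over K) M} |
        (HermitianLatticeTree.latticeTree σ ϖ ((StdForm.antidiagonal 2).over K)).dist x
          (HermitianLatticeTree.latticeTreeIso σ ϖ ((StdForm.antidiagonal 2).over K) δ x) = 2 * k}.ncard)
    _ _ _ h0 (fun k hk => by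
      rw [ite_self]
      exact ncard_displaced_eq_of_regular hT (HermitianLatticeTree.latticeTreeIso σ ϖ ((StdForm.antidiagonal 2).over K) δ) hu hfix q hdeg hk),
    ite_self]
  simp only [ite_self]
  rw [← Finset.sum_mul, sum_neg_one_pow_Ico_one_eq m hm]
  ring

end Two

/-! ## §3 The (E1) pair `(δ₁, δ₂)`: conjugacy by `diag(ϖ,1)`, the two self-dual shells add up to the total shell of `δ₁`, `Fix δ₁ = Ball(x₀, v(a−c))` -/

section Pair

variable {K : Type} [Field K] [Valued K ℤᵐ⁰] [ValuativeRel K] [(Valued.v : Valuation K ℤᵐ⁰).Compatible] {σ : K →+* K} {ϖ : K}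

omit [ValuativeRel K] [(Valued.v : Valuation K ℤᵐ⁰).Compatible] in
/-- **`δ₂ = diag(ϖ,1)·δ₁·diag(ϖ,1)⁻¹` in `GL₂(K)`** for the two (E1) literals `δ₁ = !![e(a+c), −e(a−c); −e(a−c), e(a+c)]`, `δ₂ = !![e(a+c), −e(a−c)ϖ; −e(a−c)ϖ⁻¹, e(a+c)]`
— the ★ Transport letter `hγ'` (`diag(ϖ,1) = zpowDiagGL _ ![1, 0]`). [cite: LabesseLanglands1979, §§2–3] [cite: Rogawski1990, §4.9 Lemma 4.9.3 p. 56] -/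
theorem coe_compression_pi_eq_zpowDiagGL_conj (hd : HermitianLattice.UnramifiedLocalConjDatum σ ϖ) {e a c : K}
    (δ₁ δ₂ : unitaryGroupOfForm σ ((StdForm.antidiagonal 2).over K))
    (hδ₁ : ((δ₁ : GL (Fin 2) K) : Matrix (Fin 2) (Fin 2) K) = !![e * (a + c), -(e * (a - c)); -(e * (a - c)), e * (a + c)])
    (hδ₂ : ((δ₂ : GL (Fin 2) K) : Matrix (Fin 2) (Fin 2) K) = !![e * (a + c), -(e * (a - c) * ϖ); -(e * (a - c) * ϖ⁻¹), e * (a + c)]) :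
    (δ₂ : GL (Fin 2) K) = zpowDiagGL (CartanUnique.uniformizer_ne_zero hd.vϖ) ![(1 : ℤ), 0] * (δ₁ : GL (Fin 2) K) *
      (zpowDiagGL (CartanUnique.uniformizer_ne_zero hd.vϖ) ![(1 : ℤ), 0])⁻¹ := by
  refine Units.ext (Matrix.ext fun i j => ?_)
  rw [coe_zpowDiagGL_mul_mul_inv_apply (CartanUnique.uniformizer_ne_zero hd.vϖ) ![(1 : ℤ), 0] (δ₁ : GL (Fin 2) K) i j, hδ₁, hδ₂]
  fin_cases i <;> fin_cases j <;> simp [zpow_neg, zpow_one] <;> ring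

/-- **THE TWO SELF-DUAL SHELLS OF (E1) ADD UP TO THE TOTAL SHELL OF `δ₁`**: for `↑δ₂ = diag(ϖ,1)·↑δ₁·diag(ϖ,1)⁻¹` and every `n`,
`#{x self-dual : d(x, δ₁x) = n} + #{x self-dual : d(x, δ₂x) = n} = #{x : d(x, δ₁x) = n}` whenever the right-hand shell is finite — ★ Transport
`ncard_selfDual_dist_conj_eq_ncard_modular_dist_of_datum` (the `δ₂`-shell of self-dual vertices is the `δ₁`-shell of `ϖ`-modular ones) and the type dichotomy
(every vertex of `X₂` is self-dual or `ϖ`-modular, never both ★ `not_isModularLattice_of_isSelfDualLattice_of_datum`). [cite: LabesseLanglands1979, §§2–3] [cite: Rogawski1990, §4.9 Lemma 4.9.3 p. 56] -/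
theorem ncard_selfDual_displaced_add_eq_ncard_displaced (hd : HermitianLattice.UnramifiedLocalConjDatum σ ϖ)
    (δ₁ δ₂ : unitaryGroupOfForm σ ((StdForm.antidiagonal 2).over K))
    (hδ : (δ₂ : GL (Fin 2) K) = zpowDiagGL (CartanUnique.uniformizer_ne_zero hd.vϖ) ![(1 : ℤ), 0] * (δ₁ : GL (Fin 2) K) *
      (zpowDiagGL (CartanUnique.uniformizer_ne_zero hd.vϖ) ![(1 : ℤ), 0])⁻¹) (n : ℕ)
    (hfin : {x : {M : Submodule (ValuativeRel.valuation K).integer (Fin 2 → K) // HermitianLatticeTree.IsSpecialLattice σ ϖ ((StdForm.antidiagonal 2).over K) M} |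
        (HermitianLatticeTree.latticeTree σ ϖ ((StdForm.antidiagonal 2).over K)).dist x
          (HermitianLatticeTree.latticeTreeIso σ ϖ ((StdForm.antidiagonal 2).over K) δ₁ x) = n}.Finite) :
    {x : {M : Submodule (ValuativeRel.valuation K).integer (Fin 2 → K) // HermitianLatticeTree.IsSpecialLattice σ ϖ ((StdForm.antidiagonal 2).over K) M} |
          HermitianLatticeTree.IsSelfDualLattice σ ((StdForm.antidiagonal 2).over K) x.1 ∧
            (HermitianLatticeTree.latticeTree σ ϖ ((StdForm.antidiagonal 2).over K)).dist x
              (HermitianLatticeTree.latticeTreeIso σ ϖ ((StdForm.antidiagonal 2).over K) δ₁ x) = n}.ncard +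
        {x : {M : Submodule (ValuativeRel.valuation K).integer (Fin 2 → K) // HermitianLatticeTree.IsSpecialLattice σ ϖ ((StdForm.antidiagonal 2).over K) M} |
          HermitianLatticeTree.IsSelfDualLattice σ ((StdForm.antidiagonal 2).over K) x.1 ∧
            (HermitianLatticeTree.latticeTree σ ϖ ((StdForm.antidiagonal 2).over K)).dist x
              (HermitianLatticeTree.latticeTreeIso σ ϖ ((StdForm.antidiagonal 2).over K) δ₂ x) = n}.ncard =
      {x : {M : Submodule (ValuativeRel.valuation K).integer (Fin 2 → K) // HermitianLatticeTree.IsSpecialLattice σ ϖ ((StdForm.antidiagonal 2).over K) M} |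
        (HermitianLatticeTree.latticeTree σ ϖ ((StdForm.antidiagonal 2).over K)).dist x
          (HermitianLatticeTree.latticeTreeIso σ ϖ ((StdForm.antidiagonal 2).over K) δ₁ x) = n}.ncard := by
  rw [ncard_selfDual_dist_conj_eq_ncard_modular_dist_of_datum hd δ₁ δ₂ hδ n]
  have hmod_iff : ∀ y : {M : Submodule (ValuativeRel.valuation K).integer (Fin 2 → K) // HermitianLatticeTree.IsSpecialLattice σ ϖ ((StdForm.antidiagonal 2).over K) M},
      HermitianLatticeTree.IsModularLattice σ ϖ ((StdForm.antidiagonal 2).over K) y.1 ↔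
        ¬ HermitianLatticeTree.IsSelfDualLattice σ ((StdForm.antidiagonal 2).over K) y.1 :=
    fun y => ⟨fun hm hs => not_isModularLattice_of_isSelfDualLattice_of_datum hd _ y.1 hs hm, fun hs => y.2.resolve_left hs⟩
  rw [← Set.ncard_union_eq (Set.disjoint_left.2 fun x hx hx' => (hmod_iff x).1 hx'.1 hx.1) (hfin.subset fun x hx => hx.2) (hfin.subset fun x hx => hx.2)]
  congr 1
  ext x
  simp only [Set.mem_union, Set.mem_setOf_eq, hmod_iff]
  tauto

omit [ValuativeRel K] [(Valued.v : Valuation K ℤᵐ⁰).Compatible] in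
/-- The exponent of `a − c`: for norm-one `a ≠ c` at an unramified datum, `v(a − c) = exp(−n)` for some `n : ℕ` (`|a| = |c| = 1`). [folklore] -/
theorem exists_v_sub_eq_exp_neg (hd : HermitianLattice.UnramifiedLocalConjDatum σ ϖ) {a c : K} (ha : σ a * a = 1) (hc : σ c * c = 1) (hac : a ≠ c) :
    ∃ n : ℕ, Valued.v (a - c) = WithZero.exp (-(n : ℤ)) := by
  have h0 : Valued.v (a - c) ≠ 0 := (Valuation.ne_zero_iff _).2 (sub_ne_zero.2 hac)
  have hle : Valued.v (a - c) ≤ 1 := by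
    refine (Valuation.map_sub _ _ _).trans (max_le ?_ ?_)
    · exact (flickerLiteral_norm_one_letters σ hd.vσ ha).2.le
    · exact (flickerLiteral_norm_one_letters σ hd.vσ hc).2.le
  have hlog : WithZero.log (Valued.v (a - c)) ≤ 0 := by
    rw [WithZero.log_le_iff_le_exp h0, WithZero.exp_zero]; exact hle
  refine ⟨(-WithZero.log (Valued.v (a - c))).toNat, ?_⟩
  rw [Int.toNat_of_nonneg (by omega), neg_neg, WithZero.exp_log h0]

/-- **`Fix_{X₂}(δ₁) = Ball(x₀, n)`** as a set, `n` with `v(a − c) = exp(−n)` (★ HF1 A3 `latticeTreeIso_compression_apply_eq_self_iff_dist_le`).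
[cite: LabesseLanglands1979, §§2–3] [cite: Rogawski1990, §4.9 pp. 54–55] -/
theorem setOf_compression_fixed_eq_ball (hd : HermitianLattice.UnramifiedLocalConjDatum σ ϖ) (h2 : Valued.v (2 : K) = 1)
    {e a c : K} (h2e : 2 * e = 1) (ha : σ a * a = 1) (hc : σ c * c = 1) {n : ℕ} (hn : Valued.v (a - c) = WithZero.exp (-(n : ℤ)))
    (δ : unitaryGroupOfForm σ ((StdForm.antidiagonal 2).over K))
    (hδ : ((δ : GL (Fin 2) K) : Matrix (Fin 2) (Fin 2) K) = !![e * (a + c), -(e * (a - c)); -(e * (a - c)), e * (a + c)])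
    (x₀ : {M : Submodule (ValuativeRel.valuation K).integer (Fin 2 → K) // HermitianLatticeTree.IsSpecialLattice σ ϖ ((StdForm.antidiagonal 2).over K) M})
    (hx₀ : x₀.1 = HermitianLatticeTree.latt (1 : Matrix (Fin 2) (Fin 2) K)) :
    {v | HermitianLatticeTree.latticeTreeIso σ ϖ ((StdForm.antidiagonal 2).over K) δ v = v} =
      {v | (HermitianLatticeTree.latticeTree σ ϖ ((StdForm.antidiagonal 2).over K)).dist x₀ v ≤ n} := by
  ext v
  exact latticeTreeIso_compression_apply_eq_self_iff_dist_le hd h2 h2e ha hc hn δ hδ x₀ hx₀ v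

/-- **`Fix_{X₂}(δ₁)` is finite** and contains the root (a closed ball of the locally finite connected tree ★ `ClosedBall.finite_setOf_dist_le`).
[cite: LabesseLanglands1979, §§2–3] [cite: Serre1980Trees, II.1.1] -/
theorem finite_compression_fixed (hd : HermitianLattice.UnramifiedLocalConjDatum σ ϖ) (h2 : Valued.v (2 : K) = 1)
    {e a c : K} (h2e : 2 * e = 1) (ha : σ a * a = 1) (hc : σ c * c = 1) (hac : a ≠ c)
    (δ : unitaryGroupOfForm σ ((StdForm.antidiagonal 2).over K))
    (hδ : ((δ : GL (Fin 2) K) : Matrix (Fin 2) (Fin 2) K) = !![e * (a + c), -(e * (a - c)); -(e * (a - c)), e * (a + c)])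
    (x₀ : {M : Submodule (ValuativeRel.valuation K).integer (Fin 2 → K) // HermitianLatticeTree.IsSpecialLattice σ ϖ ((StdForm.antidiagonal 2).over K) M})
    (hx₀ : x₀.1 = HermitianLatticeTree.latt (1 : Matrix (Fin 2) (Fin 2) K))
    (hloc : ∀ v, ((HermitianLatticeTree.latticeTree σ ϖ ((StdForm.antidiagonal 2).over K)).neighborSet v).Finite) :
    {v | HermitianLatticeTree.latticeTreeIso σ ϖ ((StdForm.antidiagonal 2).over K) δ v = v}.Finite ∧
      HermitianLatticeTree.latticeTreeIso σ ϖ ((StdForm.antidiagonal 2).over K) δ x₀ = x₀ := by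
  obtain ⟨n, hn⟩ := exists_v_sub_eq_exp_neg hd ha hc hac
  haveI := isDiscreteValuationRing_integer_of_compatible hd.vϖ
  have hT := HermitianLatticeTree.isTree_latticeTree σ (valuation_map_eq_of_datum hd) (isUniformizingElement_of_v_eq hd.vϖ)
    (isUnimodular₂_antidiagonal_two (K := K))
  refine ⟨?_, ?_⟩
  · rw [setOf_compression_fixed_eq_ball hd h2 h2e ha hc hn δ hδ x₀ hx₀]
    exact ClosedBall.finite_setOf_dist_le hloc hT.connected x₀ n
  · rw [latticeTreeIso_compression_apply_eq_self_iff_dist_le hd h2 h2e ha hc hn δ hδ x₀ hx₀ x₀, SimpleGraph.dist_self]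
    exact Nat.zero_le n

end Pair

/-! ## §3b `X₃`: the hyperspecial shells of a literal from its two fixed-coset counts, WITHOUT `horb` (a non-empty fixed-coset set gives the fixed vertex) -/

section Three

variable {K : Type} [Field K] [Valued K ℤᵐ⁰] [ValuativeRel K] [(Valued.v : Valuation K ℤᵐ⁰).Compatible] {σ : K →+* K} {ϖ : K}

/-- **A FIXED VERTEX FROM A NON-EMPTY FIXED-COSET SET**: if `Fix_γ(U ⧸ K₀)` and `Fix_γ(U ⧸ K₁)` are finite and one of them is non-empty, `γ` fixes a vertex of `X₃`
(★ DICT0 through ★ GF1 2a §1 `card_toFinset_fixed_eq_natCard_fixedBy_add`, `finite_fixed_vertices_of_finite_fixedBy`). [cite: Kottwitz1988, §2] [cite: Serre1980Trees, II.1.1] -/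
theorem exists_latticeGraphIso_apply_eq_self_of_fixedBy_nonempty (hd : UnramifiedLocalConjDatum σ ϖ)
    (g₁ : GL (Fin 3) K) (hg₁ : (g₁ : Matrix (Fin 3) (Fin 3) K) = Matrix.diagonal ![(1 : K), 1, ϖ])
    (γ : ↥(unitaryGroupOfForm σ ((StdForm.antidiagonal 3).over K)))
    (hfin₀ : (fixedBy (↥(unitaryGroupOfForm σ ((StdForm.antidiagonal 3).over K)) ⧸
      (glInt 3 K).subgroupOf (unitaryGroupOfForm σ ((StdForm.antidiagonal 3).over K))) γ).Finite)
    (hfin₁ : (fixedBy (↥(unitaryGroupOfForm σ ((StdForm.antidiagonal 3).over K)) ⧸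
      ((glInt 3 K).map (MulAut.conj g₁).toMonoidHom).subgroupOf (unitaryGroupOfForm σ ((StdForm.antidiagonal 3).over K))) γ).Finite)
    (hne : (fixedBy (↥(unitaryGroupOfForm σ ((StdForm.antidiagonal 3).over K)) ⧸
        (glInt 3 K).subgroupOf (unitaryGroupOfForm σ ((StdForm.antidiagonal 3).over K))) γ).Nonempty ∨
      (fixedBy (↥(unitaryGroupOfForm σ ((StdForm.antidiagonal 3).over K)) ⧸
        ((glInt 3 K).map (MulAut.conj g₁).toMonoidHom).subgroupOf (unitaryGroupOfForm σ ((StdForm.antidiagonal 3).over K))) γ).Nonempty) :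
    ∃ u : {M : Submodule 𝒪[K] (Fin 3 → K) // UnitaryLatticeTree.IsVertex σ ϖ ((StdForm.antidiagonal 3).over K) M},
      UnitaryLatticeTree.latticeGraphIso σ ϖ ((StdForm.antidiagonal 3).over K) γ u = u := by
  classical
  have hfix := finite_fixed_vertices_of_finite_fixedBy hd g₁ hg₁ γ hfin₀ hfin₁
  have hcard := card_toFinset_fixed_eq_natCard_fixedBy_add hd g₁ hg₁ γ hfix
  haveI := hfin₀.to_subtype
  haveI := hfin₁.to_subtype
  have hpos : 0 < hfix.toFinset.card := by
    rw [hcard]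
    rcases hne with h | h
    · haveI := h.to_subtype
      exact Nat.add_pos_left Nat.card_pos _
    · haveI := h.to_subtype
      exact Nat.add_pos_right _ Nat.card_pos
  obtain ⟨u, hu⟩ := Finset.card_pos.1 hpos
  exact ⟨u, (Set.Finite.mem_toFinset hfix).1 hu⟩

/-- **THE HYPERSPECIAL SHELLS OF `γ` FROM `(V₀, V₁) = (#Fix_γ(U⧸K₀), #Fix_γ(U⧸K₁))`, no `horb`** (★ GF1 2a §4 with the fixed vertex taken from the non-empty fixed-coset set
instead of the finite-orbit letter): under the residual letters (`|𝓀| = q²`, `σ̄ = Frob_q`), for `γ ∈ U₃` with finite fixed-coset sets one of which is non-empty,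
`S′₀ = V₀`, and for every `n`: `S′_{2n+1} + q^{4n}(V₀+V₁) = q^{4n}((q+1)V₁ + 1)`, `S′_{2(n+1)} + q^{4n+1}(V₀+V₁) = q^{4n+1}((q³+1)V₀ + 1)`, `S′_k = #{x self-dual : d(x, γx) = 2k}`
(★ G3 `ncard_selfDual_displaced_zero_eq_ncard_fixed_three` ∕ `…_eq_pow_mul_firstShell_three`, ★ DICT0, ★ GF1 2a §2, ★ V4 `ncard_neighborSet_eq_typeFun`).
[cite: Rogawski1990, §4.9 pp. 54–55] [cite: Serre1980Trees, I.6.4 Prop. 24] [cite: Kottwitz1988, §2] -/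
theorem ncard_selfDual_displaced_eq_of_finite_fixedBy (hd : UnramifiedLocalConjDatum σ ϖ) (hσO : ∀ x : 𝒪[K], σ x ∈ 𝒪[K]) (σk : 𝓀[K] →+* 𝓀[K])
    (hσk : ∀ x : 𝒪[K], IsLocalRing.residue 𝒪[K] ⟨σ x, hσO x⟩ = σk (IsLocalRing.residue 𝒪[K] x))
    [Fintype 𝓀[K]] {q : ℕ} (hq : Fintype.card 𝓀[K] = q ^ 2) (hfrob : ∀ y, σk y = y ^ q)
    (g₁ : GL (Fin 3) K) (hg₁ : (g₁ : Matrix (Fin 3) (Fin 3) K) = Matrix.diagonal ![(1 : K), 1, ϖ])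
    (γ : ↥(unitaryGroupOfForm σ ((StdForm.antidiagonal 3).over K)))
    (hfin₀ : (fixedBy (↥(unitaryGroupOfForm σ ((StdForm.antidiagonal 3).over K)) ⧸
      (glInt 3 K).subgroupOf (unitaryGroupOfForm σ ((StdForm.antidiagonal 3).over K))) γ).Finite)
    (hfin₁ : (fixedBy (↥(unitaryGroupOfForm σ ((StdForm.antidiagonal 3).over K)) ⧸
      ((glInt 3 K).map (MulAut.conj g₁).toMonoidHom).subgroupOf (unitaryGroupOfForm σ ((StdForm.antidiagonal 3).over K))) γ).Finite)
    (hne : (fixedBy (↥(unitaryGroupOfForm σ ((StdForm.antidiagonal 3).over K)) ⧸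
        (glInt 3 K).subgroupOf (unitaryGroupOfForm σ ((StdForm.antidiagonal 3).over K))) γ).Nonempty ∨
      (fixedBy (↥(unitaryGroupOfForm σ ((StdForm.antidiagonal 3).over K)) ⧸
        ((glInt 3 K).map (MulAut.conj g₁).toMonoidHom).subgroupOf (unitaryGroupOfForm σ ((StdForm.antidiagonal 3).over K))) γ).Nonempty) :
    ({x : {M : Submodule 𝒪[K] (Fin 3 → K) // UnitaryLatticeTree.IsVertex σ ϖ ((StdForm.antidiagonal 3).over K) M} |
          UnitaryLatticeTree.IsSelfDualLattice σ ϖ ((StdForm.antidiagonal 3).over K) x.1 ∧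
            (UnitaryLatticeTree.latticeGraph σ ϖ ((StdForm.antidiagonal 3).over K)).dist x
              (UnitaryLatticeTree.latticeGraphPerm σ ϖ ((StdForm.antidiagonal 3).over K) γ x) = 2 * 0}.ncard =
        Nat.card (fixedBy (↥(unitaryGroupOfForm σ ((StdForm.antidiagonal 3).over K)) ⧸
          (glInt 3 K).subgroupOf (unitaryGroupOfForm σ ((StdForm.antidiagonal 3).over K))) γ)) ∧
      (∀ n : ℕ,
        {x : {M : Submodule 𝒪[K] (Fin 3 → K) // UnitaryLatticeTree.IsVertex σ ϖ ((StdForm.antidiagonal 3).over K) M} |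
              UnitaryLatticeTree.IsSelfDualLattice σ ϖ ((StdForm.antidiagonal 3).over K) x.1 ∧
                (UnitaryLatticeTree.latticeGraph σ ϖ ((StdForm.antidiagonal 3).over K)).dist x
                  (UnitaryLatticeTree.latticeGraphPerm σ ϖ ((StdForm.antidiagonal 3).over K) γ x) = 2 * (2 * n + 1)}.ncard +
            q ^ (4 * n) *
              (Nat.card (fixedBy (↥(unitaryGroupOfForm σ ((StdForm.antidiagonal 3).over K)) ⧸
                  (glInt 3 K).subgroupOf (unitaryGroupOfForm σ ((StdForm.antidiagonal 3).over K))) γ) +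
                Nat.card (fixedBy (↥(unitaryGroupOfForm σ ((StdForm.antidiagonal 3).over K)) ⧸
                  ((glInt 3 K).map (MulAut.conj g₁).toMonoidHom).subgroupOf (unitaryGroupOfForm σ ((StdForm.antidiagonal 3).over K))) γ)) =
          q ^ (4 * n) *
            ((q + 1) * Nat.card (fixedBy (↥(unitaryGroupOfForm σ ((StdForm.antidiagonal 3).over K)) ⧸
              ((glInt 3 K).map (MulAut.conj g₁).toMonoidHom).subgroupOf (unitaryGroupOfForm σ ((StdForm.antidiagonal 3).over K))) γ) + 1)) ∧
      (∀ n : ℕ,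
        {x : {M : Submodule 𝒪[K] (Fin 3 → K) // UnitaryLatticeTree.IsVertex σ ϖ ((StdForm.antidiagonal 3).over K) M} |
              UnitaryLatticeTree.IsSelfDualLattice σ ϖ ((StdForm.antidiagonal 3).over K) x.1 ∧
                (UnitaryLatticeTree.latticeGraph σ ϖ ((StdForm.antidiagonal 3).over K)).dist x
                  (UnitaryLatticeTree.latticeGraphPerm σ ϖ ((StdForm.antidiagonal 3).over K) γ x) = 2 * (2 * (n + 1))}.ncard +
            q ^ (4 * n + 1) *
              (Nat.card (fixedBy (↥(unitaryGroupOfForm σ ((StdForm.antidiagonal 3).over K)) ⧸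
                  (glInt 3 K).subgroupOf (unitaryGroupOfForm σ ((StdForm.antidiagonal 3).over K))) γ) +
                Nat.card (fixedBy (↥(unitaryGroupOfForm σ ((StdForm.antidiagonal 3).over K)) ⧸
                  ((glInt 3 K).map (MulAut.conj g₁).toMonoidHom).subgroupOf (unitaryGroupOfForm σ ((StdForm.antidiagonal 3).over K))) γ)) =
          q ^ (4 * n + 1) *
            ((q ^ 3 + 1) * Nat.card (fixedBy (↥(unitaryGroupOfForm σ ((StdForm.antidiagonal 3).over K)) ⧸
              (glInt 3 K).subgroupOf (unitaryGroupOfForm σ ((StdForm.antidiagonal 3).over K))) γ) + 1)) := by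
  classical
  have hfix := finite_fixed_vertices_of_finite_fixedBy hd g₁ hg₁ γ hfin₀ hfin₁
  obtain ⟨u, hu⟩ := exists_latticeGraphIso_apply_eq_self_of_fixedBy_nonempty hd g₁ hg₁ γ hfin₀ hfin₁ hne
  obtain ⟨c, hc0⟩ := UnitaryLatticeTree.exists_typeFun (K := K) (σ := σ) (ϖ := ϖ)
  have hdeg := UnitaryLatticeTree.ncard_neighborSet_eq_typeFun hd hσO σk hσk hq hfrob hc0
  have hloc : ∀ v, ((UnitaryLatticeTree.latticeGraph σ ϖ ((StdForm.antidiagonal 3).over K)).neighborSet v).Finite := fun v =>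
    Set.finite_of_ncard_ne_zero (by rw [hdeg v]; exact Nat.succ_ne_zero _)
  have h1 := ncard_displaced_two_typeTwo_add_natCard_fixedBy_eq hd g₁ hg₁ γ hu hfix c hc0 q hdeg
  have h0 := ncard_displaced_two_selfDual_add_natCard_fixedBy_eq hd g₁ hg₁ γ hu hfix c hc0 q hdeg
  refine ⟨?_, fun n => ?_, fun n => ?_⟩
  · rw [ncard_selfDual_displaced_zero_eq_ncard_fixed_three hd γ, natCard_fixedBy_quotient_glInt_eq_ncard_selfDual_fixed hd γ]
  · have hodd : ¬ Even (2 * n + 1) := Nat.not_even_iff_odd.2 ⟨n, rfl⟩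
    rw [ncard_selfDual_displaced_eq_pow_mul_firstShell_three hd γ hloc hu hfix c hc0 q (fun v _ => hdeg v) (2 * n + 1) (by omega), if_neg hodd,
      show 2 * (2 * n + 1 - 1) = 4 * n by omega, ← mul_add, h0]
  · have heven : Even (2 * (n + 1)) := even_two_mul _
    rw [ncard_selfDual_displaced_eq_pow_mul_firstShell_three hd γ hloc hu hfix c hc0 q (fun v _ => hdeg v) (2 * (n + 1)) (by omega), if_pos heven,
      show 2 * (2 * (n + 1)) - 3 = 4 * n + 1 by omega, ← mul_add, h1]

end Three

end Summit.HodgeConjecture.HodgeConjecture.R90.S6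

end
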